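import Summits.QuantumFields.YangMills.Theorems.AllWindowsColdBoxBoxHighLineOrbitJacobianFinal
import Summits.QuantumFields.YangMills.Theorems.AllWindowsColdBoxBoxHighLineOrbitJacobianAssemblySup
import Summits.QuantumFields.YangMills.Theorems.AllWindowsColdBoxBoxHighLineOrbitMapContraction
import Summits.QuantumFields.YangMills.Theorems.AllWindowsColdBoxBoxHighLineOrbitMapBulkSurjSup
import Summits.QuantumFields.YangMills.Theorems.AllWindowsColdBoxBoxHighLineLandauBallCapacity

/-!
# T-S5.4J∞ «the orbit-normaliser Laplace asymptotics in the window `C·H⁸·(1+log β)⁵ ≤ β`» — `|N_J(V)/Z₀ − 1| ≤ β^{−p}` for every `p`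

Width seat `ym-line-sfw-p2-w2` (prover-ym-line-sfw-p2-w2-g32-0).  The by-name re-assembly of T-S5.4J for planner ym-idea-2 g18's recorded lift **L1**
of blocker **B1** of the next rung U5 (`Cruxes/BoxWindowHighSU2213/U5-BLOCKERS.md`: ✓`orbitNormaliserJacobianR` needs `C·H¹²(1+log β)⁸ ≤ β`, i.e.
`12θ < 1`; U5's window is `θ ≤ θL < 1/10`).  The honest count (bus ym-idea-1 2026-08-29T22:01Z) found THREE `H¹²` sources and this file removes
all three BY NAME:

* (α) the ℓ² Banach fixed point of ✓J4 (`C·H⁴·a ≤ 1`, ℓ²-ball) ↦ ✓J4∞ `OrbitMapSup.orbitMap_bulkSurj_sup` (sup box → SUP ball, `C(r₀+a)H² ≤ 1`,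
  `C·H²·ρ ≤ a`): inner radius `a₁ = H²(1+log β)²/√β`, ball radius `ρ = a₁/(C₄H²)`;
* (β) the PRECISION: the target is `β^{−p}` (any `p : ℕ`), not `e^{−cH⁴}` — the sup-ball Gaussian deficit is the per-coordinate union bound
  `2N·e^{−βρ²}` (✓`orbitNormaliser_lower_J_sup`, fcl-p3's ✓`LaplaceSandwich.setIntegral_exists_coord_tail_le`), `βρ² = (1+log β)⁴/C₄²`;
* (γ) the FAR region (starts at the injectivity radius `a₀ = 1/((2C₂+1)H²)` of ✓J2): ✓J5a′ `farRegionPhiLowerBall_log` (`(1+log H)⁴` in place of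
  `H⁴`, radius condition `r·H² ≤ c₀`) feeds ✓`orbitNormaliser_upper_J` with `c₅ := c·H⁴/(1+log H)⁴`, so the far cost is `e^{−cβ/(H⁴ polylog)}` against
  `Z₀⁻¹·D ≤ e^{C H⁴ (1+log β)}`.

★★★ **`OrbitJacobian.orbitNormaliserJacobian_sup (p : ℕ)`** — `∃ C > 0, ∀ H ≥ 1, ∀ β r₀ r, 2 ≤ β → C·H⁸·(1+log β)⁵ ≤ β → 0 ≤ r₀ → C·r₀·H² ≤ 1 →
r₀ + 2·(H²(1+log β)²/√β) ≤ r → C·r·H² ≤ 1 → ∀ V Landau (links ≤ r₀²), |orbitAverage H (jacWeight β H r) V / laplaceZ0 β H − 1| ≤ (β^p)⁻¹`.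
Versus ✓`OrbitNormaliserJacobianR`: window `H⁸L⁵` for `H¹²L⁸` (**`8θ < 1`**), gap `2H²L²/√β` for `1/(H⁴L²)`, cut-off `C·r·H² ≤ 1`, precision `β^{-p}`.
Everything proved; no definitions; Mathlib + tree only; standard axioms.  HONEST LABEL: a by-name glue theorem (U5 prep, helper) for the recorded lift L1
of the NEXT rung U5 (LINE-20 ⟨stmt-QuantumFields-24336⟩, UNSTAFFED, I23 open); the downstream re-packaging (FP representation / Step A letters at the new
window) and the lifts L2–L5 are not here; S5 is untouched; U5, ⟨24336⟩, ⟨24004⟩ remain OPEN; no stub is closed by name; no crux, rung or summit is proved;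
**the Yang–Mills mass gap is NOT proved by this file; no summit is proved by a line.**
-/

set_option autoImplicit false

noncomputable section

open MeasureTheory Matrix Real Metric Set
open Literature.MathematicalPhysics.QuantumFieldTheory.AxialGauge (boxEdges)
open Literature.MathematicalPhysics.QuantumLattice (gaugeTransformZd LGConfig)
open Literature.Probability.LatticeModels (Site)

namespace Summit.QuantumFields.YangMills.Theorems.AllWindowsColdBoxBoxHighLine.OrbitJacobian

open LaplaceSandwich

/-- `(β ^ p)⁻¹ = e^{−p·log β}` for `β > 0`. [folklore] -/
theorem inv_pow_eq_exp_neg {β : ℝ} (hβ : 0 < β) (p : ℕ) : (β ^ p)⁻¹ = Real.exp (-((p : ℝ) * Real.log β)) := by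
  rw [Real.exp_neg, Real.exp_nat_mul, Real.exp_log hβ]

/-- **The sup-ball deficit is polynomially small**: if `β ≥ 4`, `C₄²(p+5) ≤ 1 + log β` and `2N ≤ 96β`, then
`2N·exp(−(1+log β)⁴/C₄²) ≤ β^{−p}`. [folklore] -/
theorem supBall_deficit_le_inv_pow (p : ℕ) {β C₄ Nc : ℝ} (hβ4 : 4 ≤ β) (hC₄ : 0 < C₄)
    (hLbig : C₄ ^ 2 * (p + 5) ≤ 1 + Real.log β) (hN : 2 * Nc ≤ 96 * β) :
    2 * Nc * Real.exp (-((1 + Real.log β) ^ 4 / C₄ ^ 2)) ≤ (β ^ p)⁻¹ := by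
  have hβ : 0 < β := by linarith
  set L : ℝ := 1 + Real.log β with hL_def
  have hlogβ : 0 < Real.log β := Real.log_pos (by linarith)
  have hL1 : 1 ≤ L := by rw [hL_def]; linarith
  have hL0 : 0 < L := by linarith
  have hdefexp : -(L ^ 4 / C₄ ^ 2) ≤ -((p + 5 : ℝ) * L) := by
    rw [neg_le_neg_iff, le_div_iff₀ (by positivity)]
    have hL3 : L ≤ L ^ 3 := le_self_pow₀ hL1 (by norm_num)
    calc (p + 5 : ℝ) * L * C₄ ^ 2 = (C₄ ^ 2 * (p + 5)) * L := by ring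
      _ ≤ L * L := mul_le_mul_of_nonneg_right hLbig hL0.le
      _ ≤ L ^ 3 * L := mul_le_mul_of_nonneg_right hL3 hL0.le
      _ = L ^ 4 := by ring
  have h1 : Real.exp (-(L ^ 4 / C₄ ^ 2)) ≤ Real.exp (-((p + 5 : ℝ) * L)) := Real.exp_le_exp.2 hdefexp
  have h2 : Real.exp (-((p + 5 : ℝ) * L)) ≤ Real.exp (-((p + 5 : ℝ) * Real.log β)) := by
    refine Real.exp_le_exp.2 (neg_le_neg ?_)
    refine mul_le_mul_of_nonneg_left ?_ (by positivity)
    rw [hL_def]; linarith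
  have h3 : Real.exp (-((p + 5 : ℝ) * Real.log β)) = (β ^ (p + 5))⁻¹ := by
    rw [inv_pow_eq_exp_neg hβ (p + 5)]; push_cast; ring_nf
  have hβ4' : (96 : ℝ) ≤ β ^ 4 := by
    calc (96 : ℝ) ≤ 4 ^ 4 := by norm_num
      _ ≤ β ^ 4 := pow_le_pow_left₀ (by norm_num) hβ4 4
  have h5 : 96 * β / β ^ 5 ≤ 1 := by
    rw [div_le_one (by positivity)]
    calc 96 * β = β * 96 := by ring
      _ ≤ β * β ^ 4 := mul_le_mul_of_nonneg_left hβ4' hβ.le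
      _ = β ^ 5 := by ring
  have h6 : 0 ≤ (β ^ p)⁻¹ := by positivity
  have h4 : 96 * β * (β ^ (p + 5))⁻¹ ≤ (β ^ p)⁻¹ := by
    rw [pow_add, mul_inv, show 96 * β * ((β ^ p)⁻¹ * (β ^ 5)⁻¹) = (β ^ p)⁻¹ * (96 * β / β ^ 5) by ring]
    exact mul_le_of_le_one_right h6 h5
  calc 2 * Nc * Real.exp (-(L ^ 4 / C₄ ^ 2))
      ≤ 96 * β * Real.exp (-(L ^ 4 / C₄ ^ 2)) := mul_le_mul_of_nonneg_right hN (Real.exp_pos _).le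
    _ ≤ 96 * β * (β ^ (p + 5))⁻¹ := mul_le_mul_of_nonneg_left (h1.trans (h2.trans h3.le)) (by positivity)
    _ ≤ (β ^ p)⁻¹ := h4

set_option maxHeartbeats 800000 in
/-- ★★★ **T-S5.4J∞ — orbit-normaliser asymptotics in the window `C·H⁸·(1+log β)⁵ ≤ β` with polynomial precision.**  For every `p : ℕ` there is
`C > 0` such that for `H ≥ 1`, `β ≥ 2` with `C·H⁸(1+log β)⁵ ≤ β`, a Landau configuration `V` with cold-box links within `r₀²` (`C·r₀·H² ≤ 1`), and a
cut-off radius `r` with `r₀ + 2H²(1+log β)²/√β ≤ r` and `C·r·H² ≤ 1`:  `|N_J(V)/Z₀ − 1| ≤ β^{−p}`.  By name over J1 ✓`OrbitChart.orbitMapJacobianDet`,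
J2 ✓`orbitMapContraction`, J4∞ ✓`OrbitMapSup.orbitMap_bulkSurj_sup`, J5a′ ✓`farRegionPhiLowerBall_log`, J5b ✓`fpDetCrude`, 4p ✓`bulkCutoffOne`,
✓`orbitNormaliser_upper_J`, ✓`orbitNormaliser_lower_J_sup`. [folklore] -/
theorem orbitNormaliserJacobian_sup (p : ℕ) : ∃ C : ℝ, 0 < C ∧ ∀ H : ℕ, 1 ≤ H → ∀ β r₀ r : ℝ, 2 ≤ β →
    C * (H : ℝ) ^ 8 * (1 + Real.log β) ^ 5 ≤ β →
    0 ≤ r₀ → C * r₀ * (H : ℝ) ^ 2 ≤ 1 →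
    r₀ + 2 * ((H : ℝ) ^ 2 * (1 + Real.log β) ^ 2 / Real.sqrt β) ≤ r → C * r * (H : ℝ) ^ 2 ≤ 1 →
    ∀ V : LGConfig 4 SU2, InLandauGauge H V → (∀ e ∈ boxEdges 4 (2 * H + 1), linkDefect V e ≤ r₀ ^ 2) →
      |orbitAverage H (jacWeight β H r) V / laplaceZ0 β H - 1| ≤ (β ^ p)⁻¹ := by
  have hJ1 : OrbitMapJacobianDet := OrbitChart.orbitMapJacobianDet
  obtain ⟨C₂, hC₂, hJ2'⟩ := orbitMapContraction
  obtain ⟨C₄, hC₄, hJ4'⟩ := OrbitMapSup.orbitMap_bulkSurj_sup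
  obtain ⟨c₀', c', hc₀', hc', hJ5⟩ := farRegionPhiLowerBall_log
  obtain ⟨C_D, hCD, hDet⟩ := fpDetCrude
  set A₂ : ℝ := 2 * C₂ + 1 with hA₂_def
  have hA₂ : 1 ≤ A₂ := by rw [hA₂_def]; linarith
  set Kfar : ℝ := (64 * C_D + 73 + p) * A₂ ^ 2 / c' with hKfar_def
  have hKfar0 : 0 < Kfar := by rw [hKfar_def]; positivity
  set Cw : ℝ := max (max (max 4 C₂) (max (2 * C₄) (1 / c₀'))) (max (max (4 * C₄ ^ 2) (A₂ ^ 2)) (max Kfar (Real.exp (C₄ ^ 2 * (p + 5)))))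
    with hCw_def
  have hCw4 : 4 ≤ Cw := by simp only [hCw_def, le_max_iff, le_refl, true_or]
  have hCwC₂ : C₂ ≤ Cw := by simp only [hCw_def, le_max_iff, le_refl, true_or, or_true]
  have hCw2C₄ : 2 * C₄ ≤ Cw := by simp only [hCw_def, le_max_iff, le_refl, true_or, or_true]
  have hCwc₀ : 1 / c₀' ≤ Cw := by simp only [hCw_def, le_max_iff, le_refl, true_or, or_true]
  have hCw4C₄ : 4 * C₄ ^ 2 ≤ Cw := by simp only [hCw_def, le_max_iff, le_refl, true_or, or_true]
  have hCwA₂ : A₂ ^ 2 ≤ Cw := by simp only [hCw_def, le_max_iff, le_refl, true_or, or_true]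
  have hCwfar : Kfar ≤ Cw := by simp only [hCw_def, le_max_iff, le_refl, true_or, or_true]
  have hCwexp : Real.exp (C₄ ^ 2 * (p + 5)) ≤ Cw := by simp only [hCw_def, le_max_iff, le_refl, or_true]
  have hCw1 : 1 ≤ Cw := by linarith
  have hCw0 : 0 < Cw := by linarith
  refine ⟨Cw, hCw0, ?_⟩
  intro H hH β r₀ r hβ2 hwin hr₀ hCr₀ hgap hCr V hV hlinks
  have hβ : 0 < β := by linarith
  have hHr : (1 : ℝ) ≤ H := by exact_mod_cast hH
  have hH0 : (0 : ℝ) < H := by linarith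
  set L : ℝ := 1 + Real.log β with hL_def
  have hlogβ : 0 < Real.log β := Real.log_pos (by linarith)
  have hL1 : 1 ≤ L := by rw [hL_def]; linarith
  have hL0 : 0 < L := by linarith
  have hH2 : (1 : ℝ) ≤ (H : ℝ) ^ 2 := one_le_pow₀ hHr
  have hH4 : (1 : ℝ) ≤ (H : ℝ) ^ 4 := one_le_pow₀ hHr
  have hH8 : (1 : ℝ) ≤ (H : ℝ) ^ 8 := one_le_pow₀ hHr
  have hL5 : (1 : ℝ) ≤ L ^ 5 := one_le_pow₀ hL1
  have hL4le : L ^ 4 ≤ L ^ 5 := pow_le_pow_right₀ hL1 (by norm_num)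
  have hβCw : Cw ≤ β := by
    calc Cw = Cw * 1 * 1 := by ring
      _ ≤ Cw * (H : ℝ) ^ 8 * L ^ 5 := by gcongr
      _ ≤ β := hwin
  have hβ4 : 4 ≤ β := hCw4.trans hβCw
  have hwin4 : ∀ K : ℝ, 0 ≤ K → K ≤ Cw → K * (H : ℝ) ^ 8 * L ^ 4 ≤ β := by
    intro K hK0 hK
    calc K * (H : ℝ) ^ 8 * L ^ 4 ≤ Cw * (H : ℝ) ^ 8 * L ^ 5 := by gcongr
      _ ≤ β := hwin
  have hHβ : (H : ℝ) ≤ β := by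
    calc (H : ℝ) ≤ (H : ℝ) ^ 8 := le_self_pow₀ hHr (by norm_num)
      _ = 1 * (H : ℝ) ^ 8 * 1 := by ring
      _ ≤ Cw * (H : ℝ) ^ 8 * L ^ 5 := by gcongr
      _ ≤ β := hwin
  have hH4β : (H : ℝ) ^ 4 ≤ β := by
    calc (H : ℝ) ^ 4 ≤ (H : ℝ) ^ 8 := pow_le_pow_right₀ hHr (by norm_num)
      _ = 1 * (H : ℝ) ^ 8 * 1 := by ring
      _ ≤ Cw * (H : ℝ) ^ 8 * L ^ 5 := by gcongr
      _ ≤ β := hwin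
  have hlogH0 : 0 ≤ Real.log H := Real.log_nonneg hHr
  have hlogH : Real.log H ≤ Real.log β := Real.log_le_log hH0 hHβ
  have hLH1 : 1 ≤ 1 + Real.log (H : ℝ) := by linarith
  have hLH0 : 0 < 1 + Real.log (H : ℝ) := by linarith
  have hLH : 1 + Real.log (H : ℝ) ≤ L := by rw [hL_def]; linarith
  obtain ⟨hn1, hn16⟩ := card_interiorSites_bounds H hH
  set n' : ℝ := ((interiorSites H).card : ℝ) with hn'_def
  have hN : (Fintype.card (↥(interiorSites H) × Fin 3) : ℝ) = 3 * n' := by rw [card_prod_eq]; push_cast; rfl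
  have hsβ : 0 < Real.sqrt β := Real.sqrt_pos.2 hβ
  have hsβ2 : Real.sqrt β ^ 2 = β := Real.sq_sqrt hβ.le
  -- radii
  set a₀ : ℝ := 1 / (A₂ * (H : ℝ) ^ 2) with ha₀_def
  set a₁ : ℝ := (H : ℝ) ^ 2 * L ^ 2 / Real.sqrt β with ha₁_def
  set ρ : ℝ := a₁ / (C₄ * (H : ℝ) ^ 2) with hρ_def
  have ha₀ : 0 < a₀ := by positivity
  have ha₀1 : a₀ ≤ 1 := by
    rw [ha₀_def, div_le_one (by positivity)]; exact one_le_mul_of_one_le_of_one_le hA₂ hH2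
  have ha₀π : a₀ < Real.pi := lt_of_le_of_lt ha₀1 (by linarith [Real.pi_gt_three])
  have ha₁ : 0 < a₁ := by positivity
  have hρ : 0 ≤ ρ := by positivity
  -- `a₁ ≤ a₀` ⟸ `A₂ H⁴ L² ≤ √β` ⟸ `A₂² H⁸ L⁴ ≤ β`
  have hA₂sq : (A₂ * (H : ℝ) ^ 4 * L ^ 2) ^ 2 ≤ β := by
    have := hwin4 (A₂ ^ 2) (by positivity) hCwA₂
    calc (A₂ * (H : ℝ) ^ 4 * L ^ 2) ^ 2 = A₂ ^ 2 * (H : ℝ) ^ 8 * L ^ 4 := by ring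
      _ ≤ β := this
  have hA₂le : A₂ * (H : ℝ) ^ 4 * L ^ 2 ≤ Real.sqrt β := by
    rw [← Real.sqrt_sq (by positivity : 0 ≤ A₂ * (H : ℝ) ^ 4 * L ^ 2)]
    exact Real.sqrt_le_sqrt hA₂sq
  have ha₁a₀ : a₁ ≤ a₀ := by
    rw [ha₁_def, ha₀_def, div_le_div_iff₀ hsβ (by positivity)]
    calc (H : ℝ) ^ 2 * L ^ 2 * (A₂ * (H : ℝ) ^ 2) = A₂ * (H : ℝ) ^ 4 * L ^ 2 := by ring
      _ ≤ Real.sqrt β := hA₂le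
      _ = 1 * Real.sqrt β := (one_mul _).symm
  -- `C₄ a₁ H² ≤ 1/2` ⟸ `2C₄ H⁴ L² ≤ √β` ⟸ `4 C₄² H⁸ L⁴ ≤ β`
  have hC₄sq : (2 * C₄ * (H : ℝ) ^ 4 * L ^ 2) ^ 2 ≤ β := by
    have := hwin4 (4 * C₄ ^ 2) (by positivity) hCw4C₄
    calc (2 * C₄ * (H : ℝ) ^ 4 * L ^ 2) ^ 2 = 4 * C₄ ^ 2 * (H : ℝ) ^ 8 * L ^ 4 := by ring
      _ ≤ β := this
  have hC₄le : 2 * C₄ * (H : ℝ) ^ 4 * L ^ 2 ≤ Real.sqrt β := by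
    rw [← Real.sqrt_sq (by positivity : 0 ≤ 2 * C₄ * (H : ℝ) ^ 4 * L ^ 2)]
    exact Real.sqrt_le_sqrt hC₄sq
  have hC₄a₁ : C₄ * a₁ * (H : ℝ) ^ 2 ≤ 1 / 2 := by
    rw [ha₁_def]
    have : C₄ * ((H : ℝ) ^ 2 * L ^ 2 / Real.sqrt β) * (H : ℝ) ^ 2 = (C₄ * (H : ℝ) ^ 4 * L ^ 2) / Real.sqrt β := by
      field_simp
    rw [this, div_le_iff₀ hsβ]
    linarith
  -- cut-off radius
  have hr : 0 < r := by
    have : 0 < 2 * ((H : ℝ) ^ 2 * (1 + Real.log β) ^ 2 / Real.sqrt β) := by positivity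
    linarith
  have hr₀r : r₀ ≤ r := by
    have : 0 ≤ 2 * ((H : ℝ) ^ 2 * (1 + Real.log β) ^ 2 / Real.sqrt β) := by positivity
    linarith
  have hgap' : r₀ + 2 * a₁ ≤ r := by rw [ha₁_def, hL_def]; exact hgap
  have hrH2 : r * (H : ℝ) ^ 2 ≤ c₀' := by
    have h1 : r * (H : ℝ) ^ 2 ≤ 1 / Cw := by
      rw [le_div_iff₀ hCw0]; linarith [show r * (H : ℝ) ^ 2 * Cw = Cw * r * (H : ℝ) ^ 2 by ring]
    have h2 : 1 / Cw ≤ c₀' := by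
      rw [div_le_iff₀ hCw0]
      have := (div_le_iff₀ hc₀').1 hCwc₀
      linarith
    exact h1.trans h2
  -- J2 on the box `a₀`
  have hC₂r₀ : C₂ * r₀ * (H : ℝ) ^ 2 ≤ 1 := by
    have : C₂ * r₀ * (H : ℝ) ^ 2 ≤ Cw * r₀ * (H : ℝ) ^ 2 := by gcongr
    linarith
  obtain ⟨hF, hcontr0⟩ := hJ2' H hH r₀ a₀ hr₀ ha₀.le ha₀1 hC₂r₀ V hlinks
  have hK : (C₂ * (H : ℝ) ^ 2 * a₀) ^ 2 ≤ ((1/2 : NNReal) : ℝ) ^ 2 := by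
    have h1 : C₂ * (H : ℝ) ^ 2 * a₀ = C₂ / A₂ := by
      rw [ha₀_def]; field_simp
    have h2 : C₂ / A₂ ≤ 1 / 2 := by
      rw [div_le_iff₀ (by positivity), hA₂_def]; linarith
    have h3 : 0 ≤ C₂ / A₂ := by positivity
    rw [h1]; push_cast
    exact pow_le_pow_left₀ h3 h2 2
  have hcontr : ∀ v : ↥(interiorSites H) × Fin 3 → ℝ, (∀ x, ‖(flatten ↥(interiorSites H)).symm v x‖ ≤ a₀) →
      ∀ w : ↥(interiorSites H) × Fin 3 → ℝ,
        (w - (fpOperator H V)⁻¹ *ᵥ (fderiv ℝ (orbitMapFlat H V) v w)) ⬝ᵥ (w - (fpOperator H V)⁻¹ *ᵥ (fderiv ℝ (orbitMapFlat H V) v w)) ≤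
          ((1/2 : NNReal) : ℝ) ^ 2 * (w ⬝ᵥ w) := by
    intro v hv w
    have h := hcontr0 v (fun x => by rw [vecToField_eq_flatten_symm]; exact hv x) w
    have hww : 0 ≤ w ⬝ᵥ w := Finset.sum_nonneg fun i _ => mul_self_nonneg _
    exact h.trans (mul_le_mul_of_nonneg_right hK hww)
  -- J4∞ on the box `a₁` onto the SUP ball `ρ`
  have hJ4a : C₄ * (r₀ + a₁) * (H : ℝ) ^ 2 ≤ 1 := by
    have h1 : C₄ * r₀ * (H : ℝ) ^ 2 ≤ 1 / 2 := by
      have : 2 * C₄ * r₀ * (H : ℝ) ^ 2 ≤ Cw * r₀ * (H : ℝ) ^ 2 := by gcongr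
      linarith
    have : C₄ * (r₀ + a₁) * (H : ℝ) ^ 2 = C₄ * r₀ * (H : ℝ) ^ 2 + C₄ * a₁ * (H : ℝ) ^ 2 := by ring
    linarith
  have hJ4c : C₄ * (H : ℝ) ^ 2 * ρ ≤ a₁ := by
    have : C₄ * (H : ℝ) ^ 2 * ρ = a₁ := by rw [hρ_def]; field_simp
    exact this.le
  have hsurj := hJ4' H hH r₀ a₁ ρ hr₀ ha₁.le hρ hJ4a hJ4c V hV hlinks
  -- 4p: cut-off identically one on the box `a₁`
  have hcut : ∀ A : ↥(interiorSites H) → EuclideanSpace ℝ (Fin 3), (∀ x, ‖A x‖ ≤ a₁) →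
      ballCutoff H r (gaugeTransformZd (pauliGauge H A) V) = 1 :=
    fun A hA => bulkCutoffOne H r₀ a₁ r hr₀ ha₁.le (ha₁a₀.trans (ha₀π.le)) hr hgap' V A hlinks hA
  -- J5a′ at radius `r`: the far-region coercivity with `(1 + log H)⁴`
  have hlinksr : ∀ e ∈ boxEdges 4 (2 * H + 1), linkDefect V e ≤ r ^ 2 :=
    fun e he => (hlinks e he).trans (pow_le_pow_left₀ hr₀ hr₀r 2)
  set c₅ : ℝ := c' * (H : ℝ) ^ 4 / (1 + Real.log (H : ℝ)) ^ 4 with hc₅_def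
  have hc₅ : 0 < c₅ := by positivity
  have hfar : ∀ A : ↥(interiorSites H) → EuclideanSpace ℝ (Fin 3),
      (∀ e ∈ boxEdges 4 (2 * H + 1), linkDefect (gaugeTransformZd (pauliGauge H A) V) e < 4 * r ^ 2) → (∀ x, ‖A x‖ ≤ Real.pi) →
        ∀ x₀, c₅ * ‖A x₀‖ ^ 2 ≤ (H : ℝ) ^ 4 * landauPhi H (gaugeTransformZd (pauliGauge H A) V) := by
    intro A hW hπ x₀
    have h := hJ5 H hH r hr.le hrH2 V A hlinksr hV hW hπ x₀
    have hΦ0 : 0 ≤ landauPhi H (gaugeTransformZd (pauliGauge H A) V) := landauPhi_nonneg H _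
    rw [hc₅_def, div_mul_eq_mul_div, div_le_iff₀ (by positivity)]
    calc c' * (H : ℝ) ^ 4 * ‖A x₀‖ ^ 2 = (H : ℝ) ^ 4 * (c' * ‖A x₀‖ ^ 2) := by ring
      _ ≤ (H : ℝ) ^ 4 * ((1 + Real.log (H : ℝ)) ^ 4 * landauPhi H (gaugeTransformZd (pauliGauge H A) V)) :=
          mul_le_mul_of_nonneg_left h (by positivity)
      _ = (H : ℝ) ^ 4 * landauPhi H (gaugeTransformZd (pauliGauge H A) V) * (1 + Real.log (H : ℝ)) ^ 4 := by ring
  -- J5b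
  set D : ℝ := Real.exp (C_D * n' * (1 + Real.log n')) with hD_def
  have hdet : ∀ W : LGConfig 4 SU2, |(fpOperator H W).det| ≤ D := fun W => hDet H W
  -- the two bounds of the assembly core
  have hup := orbitNormaliser_upper_J H hJ1 hβ ha₀ ha₀π V hF hcontr hfar hdet (r := r) (c₅ := c₅)
  have hlow := orbitNormaliser_lower_J_sup H hJ1 hβ ha₀π ha₁a₀ hρ V hF hcontr hcut hsurj hdet
  -- rewrite `Z₀`
  set K : ℝ := ((2 * Real.pi ^ 2) ^ (interiorSites H).card)⁻¹ with hK_def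
  set G : ℝ := Real.sqrt (Real.pi / β) ^ Fintype.card (↥(interiorSites H) × Fin 3) with hG_def
  have hK0 : 0 < K := by positivity
  have hG0 : 0 < G := by positivity
  have hZ : laplaceZ0 β H = K * G := by rw [laplaceZ0_eq H hβ, hK_def, hG_def, card_prod_eq]
  set NJ := orbitAverage H (jacWeight β H r) V with hNJ_def
  -- lower exponential bound for `Z₀ = K·G`
  have hKexp : Real.exp (-(3 * n')) ≤ K := by
    rw [hK_def, Real.exp_neg]
    refine inv_anti₀ (by positivity) ?_
    have h1 : (2 * Real.pi ^ 2) ^ (interiorSites H).card ≤ Real.exp 3 ^ (interiorSites H).card :=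
      pow_le_pow_left₀ (by positivity) two_pi_sq_le_exp_three _
    have h2 : Real.exp 3 ^ (interiorSites H).card = Real.exp (3 * n') := by
      rw [← Real.exp_nat_mul, hn'_def]; ring_nf
    rw [← h2]; exact h1
  have hGexp : Real.exp (-(3 * n' / 2 * Real.log β)) ≤ G := by
    have h1 : Real.exp (-(Real.log β / 2)) ≤ Real.sqrt (Real.pi / β) := by
      have h2 : Real.sqrt (β⁻¹) = Real.exp (-(Real.log β / 2)) := by
        rw [Real.sqrt_eq_iff_mul_self_eq_of_pos (Real.exp_pos _), ← Real.exp_add,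
          show -(Real.log β / 2) + -(Real.log β / 2) = -Real.log β by ring, Real.exp_neg, Real.exp_log hβ]
      rw [← h2]
      refine Real.sqrt_le_sqrt ?_
      rw [div_eq_mul_inv]
      have : (1 : ℝ) * β⁻¹ ≤ Real.pi * β⁻¹ := mul_le_mul_of_nonneg_right (by linarith [Real.pi_gt_three]) (inv_nonneg.2 hβ.le)
      linarith
    have h3 : Real.exp (-(Real.log β / 2)) ^ Fintype.card (↥(interiorSites H) × Fin 3) ≤ G :=
      pow_le_pow_left₀ (Real.exp_pos _).le h1 _
    rw [← Real.exp_nat_mul, hN] at h3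
    convert h3 using 2; ring
  have hZexp : Real.exp (-(3 * n') + -(3 * n' / 2 * Real.log β)) ≤ K * G := by
    rw [Real.exp_add]; exact mul_le_mul hKexp hGexp (Real.exp_pos _).le hK0.le
  -- the target precision as an exponential
  have hprec : (β ^ p)⁻¹ = Real.exp (-((p : ℝ) * Real.log β)) := inv_pow_eq_exp_neg hβ p
  have hplog : (p : ℝ) * Real.log β ≤ (p : ℝ) * ((H : ℝ) ^ 4 * L) := by
    refine mul_le_mul_of_nonneg_left ?_ (Nat.cast_nonneg p)
    calc Real.log β ≤ L := by rw [hL_def]; linarith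
      _ = 1 * L := (one_mul L).symm
      _ ≤ (H : ℝ) ^ 4 * L := mul_le_mul_of_nonneg_right hH4 hL0.le
  -- ARITH-B: the sup-ball Gaussian deficit `2N e^{−βρ²} ≤ β^{−p}`
  have hβρ : β * ρ ^ 2 = L ^ 4 / C₄ ^ 2 := by
    rw [hρ_def, ha₁_def]
    field_simp
    rw [hsβ2]
  have hLbig : C₄ ^ 2 * (p + 5) ≤ L := by
    have h1 : C₄ ^ 2 * (p + 5) ≤ Real.log β := by
      rw [Real.le_log_iff_exp_le hβ]; exact hCwexp.trans hβCw
    rw [hL_def]; linarith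
  have hN96 : 2 * (Fintype.card (↥(interiorSites H) × Fin 3) : ℝ) ≤ 96 * β := by rw [hN]; linarith [hn16, hH4β]
  have hdeficit : 2 * (Fintype.card (↥(interiorSites H) × Fin 3) : ℝ) * Real.exp (-(β * ρ ^ 2)) ≤ (β ^ p)⁻¹ := by
    rw [hβρ]
    exact supBall_deficit_le_inv_pow p hβ4 hC₄ hLbig hN96
  -- ARITH-A: the far region against `β^{−p}·Z₀`
  have hlogn : Real.log n' ≤ 3 + 4 * Real.log β := by
    have h1 : Real.log n' ≤ Real.log (16 * (H : ℝ) ^ 4) := Real.log_le_log (by linarith) hn16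
    have h2 : Real.log (16 * (H : ℝ) ^ 4) = Real.log 16 + 4 * Real.log H := by
      rw [Real.log_mul (by norm_num) (by positivity), Real.log_pow]; push_cast; ring
    linarith [log_sixteen_le_three]
  have hfarexp : C_D * n' * (1 + Real.log n') + -(β * (c₅ * a₀ ^ 2 / (H : ℝ) ^ 4)) ≤
      -((p : ℝ) * Real.log β) + (-(3 * n') + -(3 * n' / 2 * Real.log β)) := by
    -- `βX = β c' / (A₂² H⁴ (1+log H)⁴) ≥ β c' / (A₂² H⁴ L⁴) ≥ (64 C_D + 73 + p) H⁴ L`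
    have hX : β * (c₅ * a₀ ^ 2 / (H : ℝ) ^ 4) = β * c' / (A₂ ^ 2 * (H : ℝ) ^ 4 * (1 + Real.log (H : ℝ)) ^ 4) := by
      rw [hc₅_def, ha₀_def]; field_simp
    have hX1 : β * c' / (A₂ ^ 2 * (H : ℝ) ^ 4 * L ^ 4) ≤ β * (c₅ * a₀ ^ 2 / (H : ℝ) ^ 4) := by
      rw [hX]
      refine div_le_div_of_nonneg_left (by positivity) (by positivity) ?_
      exact mul_le_mul_of_nonneg_left (pow_le_pow_left₀ hLH0.le hLH 4) (by positivity)
    have hβX : (64 * C_D + 73 + p) * (H : ℝ) ^ 4 * L ≤ β * c' / (A₂ ^ 2 * (H : ℝ) ^ 4 * L ^ 4) := by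
      rw [le_div_iff₀ (by positivity)]
      have h1 : Kfar * (H : ℝ) ^ 8 * L ^ 5 ≤ Cw * (H : ℝ) ^ 8 * L ^ 5 := by gcongr
      have h2 : Kfar * c' = (64 * C_D + 73 + p) * A₂ ^ 2 := by rw [hKfar_def]; field_simp
      have h4 : (64 * C_D + 73 + p) * (H : ℝ) ^ 4 * L * (A₂ ^ 2 * (H : ℝ) ^ 4 * L ^ 4) = (Kfar * c') * (H : ℝ) ^ 8 * L ^ 5 := by
        rw [h2]; ring
      rw [h4]
      have h7 : (Cw * (H : ℝ) ^ 8 * L ^ 5) * c' ≤ β * c' := mul_le_mul_of_nonneg_right hwin hc'.le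
      have h1' := mul_le_mul_of_nonneg_right h1 hc'.le
      linarith [h1', h7]
    -- the small terms
    have hT1 : C_D * n' * (1 + Real.log n') ≤ 64 * C_D * (H : ℝ) ^ 4 * L := by
      have h1 : 1 + Real.log n' ≤ 4 * L := by rw [hL_def]; linarith
      have h2 : 0 ≤ 1 + Real.log n' := by linarith [Real.log_nonneg hn1]
      calc C_D * n' * (1 + Real.log n') ≤ C_D * (16 * (H : ℝ) ^ 4) * (4 * L) := by gcongr
        _ = 64 * C_D * (H : ℝ) ^ 4 * L := by ring
    have hHL : (H : ℝ) ^ 4 ≤ (H : ℝ) ^ 4 * L := le_mul_of_one_le_right (by positivity) hL1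
    have hT2 : 3 * n' ≤ 48 * (H : ℝ) ^ 4 * L := by linarith
    have hT3 : 3 * n' / 2 * Real.log β ≤ 24 * (H : ℝ) ^ 4 * L := by
      have hl : Real.log β ≤ L := by rw [hL_def]; linarith
      have := mul_le_mul hn16 hl hlogβ.le (by positivity)
      linarith
    have hT4 : (p : ℝ) * Real.log β ≤ (p : ℝ) * (H : ℝ) ^ 4 * L := by linarith [hplog]
    have hT5 : 0 ≤ (H : ℝ) ^ 4 * L := by positivity
    have hβX' : 64 * C_D * (H : ℝ) ^ 4 * L + 73 * ((H : ℝ) ^ 4 * L) + (p : ℝ) * (H : ℝ) ^ 4 * L ≤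
        β * (c₅ * a₀ ^ 2 / (H : ℝ) ^ 4) := by
      have : (64 * C_D + 73 + p) * (H : ℝ) ^ 4 * L = 64 * C_D * (H : ℝ) ^ 4 * L + 73 * ((H : ℝ) ^ 4 * L) + (p : ℝ) * (H : ℝ) ^ 4 * L := by
        ring
      linarith [hβX, hX1]
    linarith [hβX', hT1, hT2, hT3, hT4, hT5]
  have hfar_le : D * Real.exp (-(β * (c₅ * a₀ ^ 2 / (H : ℝ) ^ 4))) ≤ (β ^ p)⁻¹ * (K * G) := by
    rw [hprec]
    calc D * Real.exp (-(β * (c₅ * a₀ ^ 2 / (H : ℝ) ^ 4)))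
        = Real.exp (C_D * n' * (1 + Real.log n') + -(β * (c₅ * a₀ ^ 2 / (H : ℝ) ^ 4))) := by rw [hD_def, ← Real.exp_add]
      _ ≤ Real.exp (-((p : ℝ) * Real.log β) + (-(3 * n') + -(3 * n' / 2 * Real.log β))) := Real.exp_le_exp.2 hfarexp
      _ = Real.exp (-((p : ℝ) * Real.log β)) * Real.exp (-(3 * n') + -(3 * n' / 2 * Real.log β)) := Real.exp_add _ _
      _ ≤ Real.exp (-((p : ℝ) * Real.log β)) * (K * G) := mul_le_mul_of_nonneg_left hZexp (Real.exp_pos _).le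
  -- conclude
  have hKG : 0 < K * G := mul_pos hK0 hG0
  have hprec0 : 0 ≤ (β ^ p)⁻¹ := by positivity
  rw [hZ, abs_sub_le_iff]
  constructor
  · -- upper
    rw [div_sub_one hKG.ne', div_le_iff₀ hKG]
    linarith [hup, hfar_le]
  · -- lower
    rw [one_sub_div hKG.ne', div_le_iff₀ hKG]
    have h1 : K * (G - 2 * (Fintype.card (↥(interiorSites H) × Fin 3) : ℝ) * Real.exp (-(β * ρ ^ 2)) * G) ≤ NJ := hlow
    have h2 : K * (2 * (Fintype.card (↥(interiorSites H) × Fin 3) : ℝ) * Real.exp (-(β * ρ ^ 2)) * G) ≤ K * ((β ^ p)⁻¹ * G) := by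
      refine mul_le_mul_of_nonneg_left ?_ hK0.le
      exact mul_le_mul_of_nonneg_right hdeficit hG0.le
    linarith [h1, h2]

end Summit.QuantumFields.YangMills.Theorems.AllWindowsColdBoxBoxHighLine.OrbitJacobian

end
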